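import Summits.AtomisticToContinuum.HydrodynamicLimit.Theorems.LambertianContactSwapSwapGapStubLinearConcentrationOfFourierModesTools
import Summits.AtomisticToContinuum.HydrodynamicLimit.Theorems.OneFlightGossipEngineUniformLocalGibbsConcentration
import HarnessLib

/-!
# `SwapGap` (stmt-AtomisticToContinuum-11850), line `Sketch`, stub T15: Fourier modes suffice on the `Λ`-side

Helper file (`--supports stmt-AtomisticToContinuum-11850`) of line `Sketch` (card
`entropy-relative-to-lambertian-law`) for the crux
`Summit.AtomisticToContinuum.HydrodynamicLimit.Theses.LambertianContactSwap.SwapGap`, registered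
interface stub `stub_linearConcentration_of_fourierModes` (T15) of the lead's skeleton v11: speed-`N`
self-averaging of the five linear statistics `ρ_χ, m_χ ∈ V3, e_χ` of the Lambertian gas `Λ_t` about
their `P_N ⊗ γ^ℕ`-means for every SMOOTH `χ` (the hypothesis of T5) follows from the same for the
countable family `χ ∈ {Re e_k, Im e_k : k ∈ ℤ³}`, `e_k = UnitAddTorus.mFourier k`.

Proof. `χ = ∑_k (Re ĉ_k · Re e_k − Im ĉ_k · Im e_k)` absolutely and uniformly (smooth functions have
rapidly decaying Fourier coefficients), so a finite set `S` of modes gives `|χ − χ_S| ≤ τ` uniformly.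
ENERGY EVENT (as in T7): `B_N := {1 < |e_1(p.1) − ∫E₀|}` has `(P_N ⊗ γ^ℕ)(B_N) ≤ C₁ e^{-(N+1)/C₁}`
(`uniformLocalGibbsConcentration_proof`, stmt-14445, with `χ ≡ 1`; density guard for
`σ ≤ min 1 (η₀ ∫a₀ / sup a₀)`), off `B_N` the weight `W := 1 + e_1(p.1)` is `≤ 1 + K`, and
`∫ W d(P_N ⊗ γ^ℕ) ≤ 1 + K'` uniformly in `N` (second velocity moments of the local Gibbs law). The
three statistics are linear in the test function and `|ρ_ψ| ≤ sup|ψ|`, `‖m_ψ‖ ≤ sup|ψ|(1/2 + e_1)`,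
`|e_ψ| ≤ sup|ψ| e_1` with `e_1(Λ_t p) ≤ e_1(p.1)`, so `‖X_χ(Λ_t p) − ∑_j a_j X_{mode j}(Λ_t p)‖ ≤ τ W`;
with `τ (2 + K + K') = δ/8` the abstract transfer lemma `expConc_sub_integral_of_near_finset_sum`
(union bound over the `2|S|` modes at the hypothesis' exponential rates, means `τ(1+K') ≤ δ/4`
close, tail `τ(1+K) ≤ δ/8` off `B_N`) gives each of the three bounds; the three constants add up.
`σ₀ := min (1/2) (min σ₁ σ₂)`.

prover-line-stmt-AtomisticToContinuum-11850-c5-0 (wave 7 worker), cycle 6.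
-/

noncomputable section

open MeasureTheory Filter Set Topology
open scoped ENNReal

namespace Summit.AtomisticToContinuum.HydrodynamicLimit.Theorems

open Literature.Analysis.FluidPDE Literature.MathematicalPhysics.KineticTheory
open Summit.AtomisticToContinuum.HydrodynamicLimit.Theses.LambertianContactSwap
open Summit.AtomisticToContinuum.HydrodynamicLimit.Theorems.LinearConcentrationOfFourierModes

/-! ### T15: Fourier modes suffice on the `Λ`-side -/

/-- **T15 · FOURIER MODES SUFFICE ON THE Λ-SIDE** (`stub_linearConcentration_of_fourierModes`,
registered stub of line `Sketch` of stmt-AtomisticToContinuum-11850): speed-`N` self-averaging of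
the linear statistics `ρ_χ, m_χ, e_χ` of the Lambertian gas `Λ_t` about their `P_N ⊗ γ^ℕ`-means,
for every smooth `χ`, follows from the same for the countable family `χ ∈ {Re e_k, Im e_k}`,
`e_k = UnitAddTorus.mFourier k`. Proof: `χ = ∑_k (Re ĉ_k Re e_k − Im ĉ_k Im e_k)` absolutely and
uniformly (`LinearConcentrationOfFourierModes.hasSum_re_fourier_of_isSmooth`), so a finite set `S`
of modes gives `|χ − χ_S| ≤ τ` with `τ (2 + K + K') = δ/8`, where `K` bounds the kinetic energy per
particle off the exponentially small energy event `{1 < |e_1(p.1) − ∫E₀|}`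
(`uniformLocalGibbsConcentration_proof` with `χ ≡ 1`, `e_1(Λ_t p) ≤ e_1(p.1)`) and `K'` its
`P_N`-mean (`exists_integral_empiricalEnergyField_one_le`); the three statistics are linear in the
test function and bounded by `sup|ψ| (1 + e_1)`, so `‖X_χ − ∑_{j} a_j X_{mode j}‖ ≤ τ (1 + e_1(p.1))`
and the abstract transfer lemma `expConc_sub_integral_of_near_finset_sum` (union bound over the
`2|S|` modes, means `τ(1 + K')`-close) concludes; `σ₀ := min (1/2) (min σ₁ σ₂)` with `σ₂` from the
density guard of stmt-14445 as in T7. [folklore] -/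
theorem stub_linearConcentration_of_fourierModes
    (hmodes :
    ∀ (a₀ θ₀ : T3 → ℝ) (u₀ : T3 → V3), Continuous a₀ → Continuous θ₀ → Continuous u₀ →
      (∀ x, 0 < a₀ x) → (∀ x, 0 < θ₀ x) →
      ∃ σ₀ : ℝ, 0 < σ₀ ∧ ∀ σ : ℝ, 0 < σ → σ < σ₀ →
        ∀ (T : ℝ) (ρ θ : ℝ → T3 → ℝ) (u : ℝ → T3 → V3), IsHardSphereEulerSolution σ T ρ u θ →
          ∀ Φ : (N : ℕ) → HardSphereFlow (Torus.geometry (Fin 3)) (hsDiameter σ N) (N + 1),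
            TendstoHydroFieldsAt (fun N => localGibbsLaw σ a₀ u₀ θ₀ N (Φ N)) Φ ρ u θ 0 →
              ∀ t ∈ Set.Ico 0 T, ∀ (k : Fin 3 → ℤ) (χ : T3 → ℝ),
                ((χ = fun x => (UnitAddTorus.mFourier k x).re) ∨ (χ = fun x => (UnitAddTorus.mFourier k x).im)) →
              ∀ δ : ℝ, 0 < δ →
                ∃ C : ℝ, 0 < C ∧ ∀ N : ℕ,
                  ((localGibbsLaw σ a₀ u₀ θ₀ N (Φ N)).prod (lambertNoise (Fin 3)))
                      {p | δ < |empiricalDensityField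
                          (lambertFlow (Torus.geometry (Fin 3)) (hsDiameter σ N) p.2 p.1 t) χ -
                        ∫ q, empiricalDensityField
                          (lambertFlow (Torus.geometry (Fin 3)) (hsDiameter σ N) q.2 q.1 t) χ
                          ∂((localGibbsLaw σ a₀ u₀ θ₀ N (Φ N)).prod (lambertNoise (Fin 3)))|} ≤
                    ENNReal.ofReal (C * Real.exp (-(C⁻¹ * ((N : ℝ) + 1)))) ∧
                  ((localGibbsLaw σ a₀ u₀ θ₀ N (Φ N)).prod (lambertNoise (Fin 3)))
                      {p | δ < ‖empiricalMomentumField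
                          (lambertFlow (Torus.geometry (Fin 3)) (hsDiameter σ N) p.2 p.1 t) χ -
                        ∫ q, empiricalMomentumField
                          (lambertFlow (Torus.geometry (Fin 3)) (hsDiameter σ N) q.2 q.1 t) χ
                          ∂((localGibbsLaw σ a₀ u₀ θ₀ N (Φ N)).prod (lambertNoise (Fin 3)))‖} ≤
                    ENNReal.ofReal (C * Real.exp (-(C⁻¹ * ((N : ℝ) + 1)))) ∧
                  ((localGibbsLaw σ a₀ u₀ θ₀ N (Φ N)).prod (lambertNoise (Fin 3)))
                      {p | δ < |empiricalEnergyField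
                          (lambertFlow (Torus.geometry (Fin 3)) (hsDiameter σ N) p.2 p.1 t) χ -
                        ∫ q, empiricalEnergyField
                          (lambertFlow (Torus.geometry (Fin 3)) (hsDiameter σ N) q.2 q.1 t) χ
                          ∂((localGibbsLaw σ a₀ u₀ θ₀ N (Φ N)).prod (lambertNoise (Fin 3)))|} ≤
                    ENNReal.ofReal (C * Real.exp (-(C⁻¹ * ((N : ℝ) + 1))))) :
    ∀ (a₀ θ₀ : T3 → ℝ) (u₀ : T3 → V3), Continuous a₀ → Continuous θ₀ → Continuous u₀ →
      (∀ x, 0 < a₀ x) → (∀ x, 0 < θ₀ x) →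
      ∃ σ₀ : ℝ, 0 < σ₀ ∧ ∀ σ : ℝ, 0 < σ → σ < σ₀ →
        ∀ (T : ℝ) (ρ θ : ℝ → T3 → ℝ) (u : ℝ → T3 → V3), IsHardSphereEulerSolution σ T ρ u θ →
          ∀ Φ : (N : ℕ) → HardSphereFlow (Torus.geometry (Fin 3)) (hsDiameter σ N) (N + 1),
            TendstoHydroFieldsAt (fun N => localGibbsLaw σ a₀ u₀ θ₀ N (Φ N)) Φ ρ u θ 0 →
              ∀ t ∈ Set.Ico 0 T, ∀ χ : T3 → ℝ, Literature.Analysis.FunctionSpaces.Torus.IsSmooth χ → ∀ δ : ℝ, 0 < δ →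
                ∃ C : ℝ, 0 < C ∧ ∀ N : ℕ,
                  ((localGibbsLaw σ a₀ u₀ θ₀ N (Φ N)).prod (lambertNoise (Fin 3)))
                      {p | δ < |empiricalDensityField
                          (lambertFlow (Torus.geometry (Fin 3)) (hsDiameter σ N) p.2 p.1 t) χ -
                        ∫ q, empiricalDensityField
                          (lambertFlow (Torus.geometry (Fin 3)) (hsDiameter σ N) q.2 q.1 t) χ
                          ∂((localGibbsLaw σ a₀ u₀ θ₀ N (Φ N)).prod (lambertNoise (Fin 3)))|} ≤
                    ENNReal.ofReal (C * Real.exp (-(C⁻¹ * ((N : ℝ) + 1)))) ∧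
                  ((localGibbsLaw σ a₀ u₀ θ₀ N (Φ N)).prod (lambertNoise (Fin 3)))
                      {p | δ < ‖empiricalMomentumField
                          (lambertFlow (Torus.geometry (Fin 3)) (hsDiameter σ N) p.2 p.1 t) χ -
                        ∫ q, empiricalMomentumField
                          (lambertFlow (Torus.geometry (Fin 3)) (hsDiameter σ N) q.2 q.1 t) χ
                          ∂((localGibbsLaw σ a₀ u₀ θ₀ N (Φ N)).prod (lambertNoise (Fin 3)))‖} ≤
                    ENNReal.ofReal (C * Real.exp (-(C⁻¹ * ((N : ℝ) + 1)))) ∧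
                  ((localGibbsLaw σ a₀ u₀ θ₀ N (Φ N)).prod (lambertNoise (Fin 3)))
                      {p | δ < |empiricalEnergyField
                          (lambertFlow (Torus.geometry (Fin 3)) (hsDiameter σ N) p.2 p.1 t) χ -
                        ∫ q, empiricalEnergyField
                          (lambertFlow (Torus.geometry (Fin 3)) (hsDiameter σ N) q.2 q.1 t) χ
                          ∂((localGibbsLaw σ a₀ u₀ θ₀ N (Φ N)).prod (lambertNoise (Fin 3)))|} ≤
                    ENNReal.ofReal (C * Real.exp (-(C⁻¹ * ((N : ℝ) + 1)))) := by
  obtain ⟨η₀, hη₀, hU⟩ := uniformLocalGibbsConcentration_proof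
  intro a₀ θ₀ u₀ ha hθ hu ha0 hθ0
  obtain ⟨σ₁, hσ₁, h1⟩ := hmodes a₀ θ₀ u₀ ha hθ hu ha0 hθ0
  -- the density guard of `uniformLocalGibbsConcentration_proof` (as in T7)
  have hbdd : BddAbove (Set.range a₀) := (isCompact_range ha).bddAbove
  have hsup_ge : ∀ x, a₀ x ≤ ⨆ y, a₀ y := fun x => le_ciSup hbdd x
  have hS : 0 < ⨆ y, a₀ y := (ha0 0).trans_le (hsup_ge 0)
  have hI : 0 < ∫ y, a₀ y := integral_pos_of_continuous_pos ha ha0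
  set σ₂ : ℝ := min 1 (η₀ * (∫ y, a₀ y) / ⨆ y, a₀ y) with hσ₂def
  have hσ₂ : 0 < σ₂ := lt_min one_pos (by positivity)
  refine ⟨min 2⁻¹ (min σ₁ σ₂), lt_min (by norm_num) (lt_min hσ₁ hσ₂), ?_⟩
  intro σ hσ hσlt T ρ θ u hE Φ h0 t ht χ hχ δ hδ
  have hσhalf : σ < 2⁻¹ := hσlt.trans_le (min_le_left _ _)
  have hσσ₁ : σ < σ₁ := (hσlt.trans_le (min_le_right _ _)).trans_le (min_le_left _ _)
  have hσσ₂ : σ < σ₂ := (hσlt.trans_le (min_le_right _ _)).trans_le (min_le_right _ _)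
  have hσ1 : σ ≤ 1 := hσσ₂.le.trans (min_le_left _ _)
  have hσ12 : σ ≤ 1 / 2 := by rw [one_div]; exact hσhalf.le
  have hσq : σ ≤ η₀ * (∫ y, a₀ y) / ⨆ y, a₀ y := hσσ₂.le.trans (min_le_right _ _)
  have hguard : σ ^ 3 * (⨆ y, a₀ y) ≤ η₀ * ∫ y, a₀ y := by
    have h3 : σ ^ 3 ≤ σ := by
      have := pow_le_pow_of_le_one hσ.le hσ1 (by norm_num : 1 ≤ 3)
      simpa using this
    calc σ ^ 3 * (⨆ y, a₀ y) ≤ σ * ⨆ y, a₀ y := mul_le_mul_of_nonneg_right h3 hS.le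
      _ ≤ (η₀ * (∫ y, a₀ y) / ⨆ y, a₀ y) * ⨆ y, a₀ y := mul_le_mul_of_nonneg_right hσq hS.le
      _ = η₀ * ∫ y, a₀ y := div_mul_cancel₀ _ hS.ne'
  obtain ⟨ρ₀, -, -, hP, hconc⟩ := hU a₀ θ₀ u₀ ha hθ hu ha0 hθ0 σ hσ hguard
  -- ENERGY EVENT: `χ ≡ 1` at level `1`
  obtain ⟨C₁, hC₁, hC₁N⟩ := hconc (fun _ => (1 : ℝ)) continuous_const 1 one_pos
  set Ebar : ℝ := ∫ x, (1 : ℝ) * totalEnergyDensity (ρ₀ x) (u₀ x) (θ₀ x) with hEbar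
  set K : ℝ := |Ebar| + 1 with hK
  have hK0 : 0 ≤ K := by positivity
  -- FIRST MOMENT of the kinetic energy per particle
  obtain ⟨K', hK'0, hK'⟩ := exists_integral_empiricalEnergyField_one_le ha hθ hu ha0 hθ0 hσ12
  -- notation
  set Q : (N : ℕ) → Measure (Config (N + 1) (Fin 3) T3 × (ℕ → EuclideanSpace ℝ (Fin 3))) :=
    fun N => (localGibbsLaw σ a₀ u₀ θ₀ N (Φ N)).prod (lambertNoise (Fin 3)) with hQ
  set W : (N : ℕ) → Config (N + 1) (Fin 3) T3 × (ℕ → EuclideanSpace ℝ (Fin 3)) → ℝ :=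
    fun N p => 1 + empiricalEnergyField p.1 (fun _ => 1) with hW
  have hWi : ∀ N, Integrable (W N) (Q N) := fun N => by
    haveI := hP N (Φ N)
    exact ((integrable_const (1 : ℝ)).add (hK' N (Φ N)).1).comp_fst (lambertNoise (Fin 3))
  have hWM : ∀ N, ∫ p, W N p ∂Q N ≤ 1 + K' := by
    intro N
    haveI := hP N (Φ N)
    have h2 : ∫ p, W N p ∂Q N =
        ∫ z, (1 + empiricalEnergyField z (fun _ => 1)) ∂localGibbsLaw σ a₀ u₀ θ₀ N (Φ N) := by
      have := integral_fun_fst (μ := localGibbsLaw σ a₀ u₀ θ₀ N (Φ N)) (ν := lambertNoise (Fin 3))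
        (fun z : Config (N + 1) (Fin 3) T3 => 1 + empiricalEnergyField z (fun _ => 1))
      rw [probReal_univ, one_smul] at this
      exact this
    rw [h2, integral_add (integrable_const _) (hK' N (Φ N)).1, integral_const, probReal_univ,
      one_smul]
    linarith [(hK' N (Φ N)).2]
  -- the energy event under `Q N`
  set B : (N : ℕ) → Set (Config (N + 1) (Fin 3) T3 × (ℕ → EuclideanSpace ℝ (Fin 3))) :=
    fun N => {p | 1 < |empiricalEnergyField p.1 (fun _ => 1) - Ebar|} with hB
  have hBQ : ∀ N, Q N (B N) ≤ ENNReal.ofReal (C₁ * Real.exp (-(C₁⁻¹ * ((N : ℝ) + 1)))) := by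
    intro N
    haveI := hP N (Φ N)
    have hsub : B N ⊆
        {z : Config (N + 1) (Fin 3) T3 | 1 < |empiricalEnergyField z (fun _ => 1) - Ebar|} ×ˢ
          (univ : Set (ℕ → EuclideanSpace ℝ (Fin 3))) :=
      fun p hp => ⟨hp, mem_univ _⟩
    calc Q N (B N)
        ≤ Q N ({z : Config (N + 1) (Fin 3) T3 | 1 < |empiricalEnergyField z (fun _ => 1) - Ebar|} ×ˢ
            (univ : Set (ℕ → EuclideanSpace ℝ (Fin 3)))) := measure_mono hsub
      _ ≤ localGibbsLaw σ a₀ u₀ θ₀ N (Φ N)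
              {z | 1 < |empiricalEnergyField z (fun _ => 1) - Ebar|} *
            lambertNoise (Fin 3) (univ : Set (ℕ → EuclideanSpace ℝ (Fin 3))) :=
          Measure.prod_prod_le _ _
      _ = localGibbsLaw σ a₀ u₀ θ₀ N (Φ N)
              {z | 1 < |empiricalEnergyField z (fun _ => 1) - Ebar|} := by
          rw [measure_univ, mul_one]
      _ ≤ ENNReal.ofReal (C₁ * Real.exp (-(C₁⁻¹ * ((N : ℝ) + 1)))) := (hC₁N N (Φ N)).2.2
  have hWL : ∀ N p, p ∉ B N → W N p ≤ 1 + K := by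
    intro N p hp
    have hp' : ¬ (1 < |empiricalEnergyField p.1 (fun _ => 1) - Ebar|) := hp
    have h1 := le_abs_self (empiricalEnergyField p.1 (fun _ => 1) - Ebar)
    have h2 := le_abs_self Ebar
    simp only [hW]
    linarith [not_lt.1 hp']
  -- FOURIER: truncation level and the finite set of modes
  set τ : ℝ := δ / (8 * (2 + K + K')) with hτdef
  have hD : 0 < 2 + K + K' := by positivity
  have hτ : 0 < τ := by positivity
  have hτD : τ * (2 + K + K') = δ / 8 := by rw [hτdef]; field_simp
  have hτL : τ * (1 + K) ≤ δ / 8 := by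
    rw [← hτD]; exact mul_le_mul_of_nonneg_left (by linarith) hτ.le
  have hτM : τ * (1 + K') ≤ δ / 4 := by
    have : τ * (1 + K') ≤ δ / 8 := by
      rw [← hτD]; exact mul_le_mul_of_nonneg_left (by linarith) hτ.le
    linarith
  obtain ⟨hsum, hHas⟩ := hasSum_re_fourier_of_isSmooth hχ
  set c : (Fin 3 → ℤ) → ℂ := UnitAddTorus.mFourierCoeff (fun x => (χ x : ℂ)) with hc
  obtain ⟨S, hSτ⟩ := exists_finset_uniform_tail
    (fun k x => (c k).re * (UnitAddTorus.mFourier k x).re - (c k).im * (UnitAddTorus.mFourier k x).im)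
    (fun k => ‖c k‖) χ hsum (fun k x => abs_re_fourier_term_le (c k) k x) hHas hτ
  -- the `2|S|` modes, their coefficients, and the truncation `χ_S = ∑_j a_j mode_j`
  set a : (Fin 3 → ℤ) ⊕ (Fin 3 → ℤ) → ℝ := Sum.elim (fun k => (c k).re) (fun k => -(c k).im) with ha_def
  set mode : (Fin 3 → ℤ) ⊕ (Fin 3 → ℤ) → T3 → ℝ :=
    Sum.elim (fun k x => (UnitAddTorus.mFourier k x).re) (fun k x => (UnitAddTorus.mFourier k x).im)
    with hmode_def
  have hmode_cont : ∀ j, Continuous (mode j) := by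
    rintro (k | k)
    · exact Complex.continuous_re.comp (UnitAddTorus.mFourier k).continuous
    · exact Complex.continuous_im.comp (UnitAddTorus.mFourier k).continuous
  have hmode_hyp : ∀ j : (Fin 3 → ℤ) ⊕ (Fin 3 → ℤ),
      ((mode j = fun x => (UnitAddTorus.mFourier (Sum.elim id id j) x).re) ∨
        (mode j = fun x => (UnitAddTorus.mFourier (Sum.elim id id j) x).im)) := by
    rintro (k | k)
    · exact Or.inl rfl
    · exact Or.inr rfl
  have hclose : ∀ x, |(∑ j ∈ S.disjSum S, a j * mode j x) - χ x| ≤ τ := by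
    intro x
    have e : ∑ j ∈ S.disjSum S, a j * mode j x = ∑ k ∈ S, ((c k).re * (UnitAddTorus.mFourier k x).re -
        (c k).im * (UnitAddTorus.mFourier k x).im) := by
      rw [Finset.sum_disjSum, ← Finset.sum_add_distrib]
      refine Finset.sum_congr rfl fun k _ => ?_
      simp only [ha_def, hmode_def, Sum.elim_inl, Sum.elim_inr]
      ring
    rw [abs_sub_comm, e]
    exact hSτ x
  -- integrability of the statistics, and the modes' hypothesis under `Q N`
  have hInt : ∀ N {ψ : T3 → ℝ}, Continuous ψ →
      Integrable (fun p : Config (N + 1) (Fin 3) T3 × (ℕ → EuclideanSpace ℝ (Fin 3)) =>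
        empiricalDensityField (lambertFlow (Torus.geometry (Fin 3)) (hsDiameter σ N) p.2 p.1 t) ψ) (Q N) ∧
      Integrable (fun p : Config (N + 1) (Fin 3) T3 × (ℕ → EuclideanSpace ℝ (Fin 3)) =>
        empiricalMomentumField (lambertFlow (Torus.geometry (Fin 3)) (hsDiameter σ N) p.2 p.1 t) ψ) (Q N) ∧
      Integrable (fun p : Config (N + 1) (Fin 3) T3 × (ℕ → EuclideanSpace ℝ (Fin 3)) =>
        empiricalEnergyField (lambertFlow (Torus.geometry (Fin 3)) (hsDiameter σ N) p.2 p.1 t) ψ) (Q N) :=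
    fun N ψ hψ => integrable_fields_lambertFlow hσ.le hσhalf N (Φ N) (hP N (Φ N)) (hK' N (Φ N)).1 t hψ
  have hY : ∀ j, ∀ δ' : ℝ, 0 < δ' → ∃ C : ℝ, 0 < C ∧ ∀ N : ℕ,
      Q N {p | δ' < ‖empiricalDensityField
              (lambertFlow (Torus.geometry (Fin 3)) (hsDiameter σ N) p.2 p.1 t) (mode j) -
            ∫ q, empiricalDensityField
              (lambertFlow (Torus.geometry (Fin 3)) (hsDiameter σ N) q.2 q.1 t) (mode j) ∂Q N‖} ≤
        ENNReal.ofReal (C * Real.exp (-(C⁻¹ * ((N : ℝ) + 1)))) ∧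
      Q N {p | δ' < ‖empiricalMomentumField
              (lambertFlow (Torus.geometry (Fin 3)) (hsDiameter σ N) p.2 p.1 t) (mode j) -
            ∫ q, empiricalMomentumField
              (lambertFlow (Torus.geometry (Fin 3)) (hsDiameter σ N) q.2 q.1 t) (mode j) ∂Q N‖} ≤
        ENNReal.ofReal (C * Real.exp (-(C⁻¹ * ((N : ℝ) + 1)))) ∧
      Q N {p | δ' < ‖empiricalEnergyField
              (lambertFlow (Torus.geometry (Fin 3)) (hsDiameter σ N) p.2 p.1 t) (mode j) -
            ∫ q, empiricalEnergyField
              (lambertFlow (Torus.geometry (Fin 3)) (hsDiameter σ N) q.2 q.1 t) (mode j) ∂Q N‖} ≤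
        ENNReal.ofReal (C * Real.exp (-(C⁻¹ * ((N : ℝ) + 1)))) := by
    intro j δ' hδ'
    obtain ⟨C, hC, hCN⟩ :=
      h1 σ hσ hσσ₁ T ρ θ u hE Φ h0 t ht (Sum.elim id id j) (mode j) (hmode_hyp j) δ' hδ'
    refine ⟨C, hC, fun N => ?_⟩
    simpa only [hQ, Real.norm_eq_abs] using hCN N
  -- the three statistics of `χ` are `τ W`-close to those of `χ_S`
  have hnear : ∀ N (p : Config (N + 1) (Fin 3) T3 × (ℕ → EuclideanSpace ℝ (Fin 3))),
      |empiricalDensityField (lambertFlow (Torus.geometry (Fin 3)) (hsDiameter σ N) p.2 p.1 t) χ -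
        empiricalDensityField (lambertFlow (Torus.geometry (Fin 3)) (hsDiameter σ N) p.2 p.1 t)
          (fun x => ∑ j ∈ S.disjSum S, a j * mode j x)| ≤ τ * W N p ∧
      ‖empiricalMomentumField (lambertFlow (Torus.geometry (Fin 3)) (hsDiameter σ N) p.2 p.1 t) χ -
        empiricalMomentumField (lambertFlow (Torus.geometry (Fin 3)) (hsDiameter σ N) p.2 p.1 t)
          (fun x => ∑ j ∈ S.disjSum S, a j * mode j x)‖ ≤ τ * W N p ∧
      |empiricalEnergyField (lambertFlow (Torus.geometry (Fin 3)) (hsDiameter σ N) p.2 p.1 t) χ -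
        empiricalEnergyField (lambertFlow (Torus.geometry (Fin 3)) (hsDiameter σ N) p.2 p.1 t)
          (fun x => ∑ j ∈ S.disjSum S, a j * mode j x)| ≤ τ * W N p := by
    intro N p
    obtain ⟨hd, hm, hen⟩ :=
      empiricalFields_sub_le (lambertFlow (Torus.geometry (Fin 3)) (hsDiameter σ N) p.2 p.1 t) hclose
    obtain ⟨he0, he⟩ := kineticEnergy_lambertFlow_bounds (hsDiameter σ N) p.2 p.1 t
    have hW1 : 1 + empiricalEnergyField p.1 (fun _ => 1) = W N p := rfl
    refine ⟨?_, ?_, ?_⟩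
    · rw [abs_sub_comm, ← hW1]
      exact hd.trans (le_mul_of_one_le_right hτ.le (by linarith))
    · rw [norm_sub_rev, ← hW1]
      exact hm.trans (mul_le_mul_of_nonneg_left (by linarith) hτ.le)
    · rw [abs_sub_comm, ← hW1]
      exact hen.trans (mul_le_mul_of_nonneg_left (by linarith) hτ.le)
  -- DENSITY
  obtain ⟨Cd, hCd, hdN⟩ := expConc_sub_integral_of_near_finset_sum (E := ℝ) Q (S.disjSum S) a
    (fun j N p => empiricalDensityField
      (lambertFlow (Torus.geometry (Fin 3)) (hsDiameter σ N) p.2 p.1 t) (mode j))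
    (fun j _ N => (hInt N (hmode_cont j)).1) (fun j _ δ' hδ' => by
      obtain ⟨C, hC, hCN⟩ := hY j δ' hδ'
      exact ⟨C, hC, fun N => (hCN N).1⟩)
    (fun N p => empiricalDensityField
      (lambertFlow (Torus.geometry (Fin 3)) (hsDiameter σ N) p.2 p.1 t) χ)
    (fun N => (hInt N hχ.continuous).1) W hWi hWM B hWL hC₁ hBQ hτ.le hδ hτL hτM
    (fun N p => by
      rw [← empiricalDensityField_finset_sum_mul, Real.norm_eq_abs]
      exact (hnear N p).1)
  -- MOMENTUM
  obtain ⟨Cm, hCm, hmN⟩ := expConc_sub_integral_of_near_finset_sum (E := V3) Q (S.disjSum S) a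
    (fun j N p => empiricalMomentumField
      (lambertFlow (Torus.geometry (Fin 3)) (hsDiameter σ N) p.2 p.1 t) (mode j))
    (fun j _ N => (hInt N (hmode_cont j)).2.1) (fun j _ δ' hδ' => by
      obtain ⟨C, hC, hCN⟩ := hY j δ' hδ'
      exact ⟨C, hC, fun N => (hCN N).2.1⟩)
    (fun N p => empiricalMomentumField
      (lambertFlow (Torus.geometry (Fin 3)) (hsDiameter σ N) p.2 p.1 t) χ)
    (fun N => (hInt N hχ.continuous).2.1) W hWi hWM B hWL hC₁ hBQ hτ.le hδ hτL hτM
    (fun N p => by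
      rw [← empiricalMomentumField_finset_sum_mul]
      exact (hnear N p).2.1)
  -- ENERGY
  obtain ⟨Ce, hCe, heN⟩ := expConc_sub_integral_of_near_finset_sum (E := ℝ) Q (S.disjSum S) a
    (fun j N p => empiricalEnergyField
      (lambertFlow (Torus.geometry (Fin 3)) (hsDiameter σ N) p.2 p.1 t) (mode j))
    (fun j _ N => (hInt N (hmode_cont j)).2.2) (fun j _ δ' hδ' => by
      obtain ⟨C, hC, hCN⟩ := hY j δ' hδ'
      exact ⟨C, hC, fun N => (hCN N).2.2⟩)
    (fun N p => empiricalEnergyField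
      (lambertFlow (Torus.geometry (Fin 3)) (hsDiameter σ N) p.2 p.1 t) χ)
    (fun N => (hInt N hχ.continuous).2.2) W hWi hWM B hWL hC₁ hBQ hτ.le hδ hτL hτM
    (fun N p => by
      rw [← empiricalEnergyField_finset_sum_mul, Real.norm_eq_abs]
      exact (hnear N p).2.2)
  -- one constant for the three bounds
  have hC3 : 0 < Cd + Cm + Ce := by positivity
  have hfinal : ∀ N : ℕ,
      Q N {p | δ < |empiricalDensityField
              (lambertFlow (Torus.geometry (Fin 3)) (hsDiameter σ N) p.2 p.1 t) χ -
            ∫ q, empiricalDensityField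
              (lambertFlow (Torus.geometry (Fin 3)) (hsDiameter σ N) q.2 q.1 t) χ ∂Q N|} ≤
        ENNReal.ofReal ((Cd + Cm + Ce) * Real.exp (-((Cd + Cm + Ce)⁻¹ * ((N : ℝ) + 1)))) ∧
      Q N {p | δ < ‖empiricalMomentumField
              (lambertFlow (Torus.geometry (Fin 3)) (hsDiameter σ N) p.2 p.1 t) χ -
            ∫ q, empiricalMomentumField
              (lambertFlow (Torus.geometry (Fin 3)) (hsDiameter σ N) q.2 q.1 t) χ ∂Q N‖} ≤
        ENNReal.ofReal ((Cd + Cm + Ce) * Real.exp (-((Cd + Cm + Ce)⁻¹ * ((N : ℝ) + 1)))) ∧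
      Q N {p | δ < |empiricalEnergyField
              (lambertFlow (Torus.geometry (Fin 3)) (hsDiameter σ N) p.2 p.1 t) χ -
            ∫ q, empiricalEnergyField
              (lambertFlow (Torus.geometry (Fin 3)) (hsDiameter σ N) q.2 q.1 t) χ ∂Q N|} ≤
        ENNReal.ofReal ((Cd + Cm + Ce) * Real.exp (-((Cd + Cm + Ce)⁻¹ * ((N : ℝ) + 1)))) := by
    intro N
    refine ⟨?_, ?_, ?_⟩
    · have h := hdN N
      simp only [Real.norm_eq_abs] at h
      exact h.trans (ENNReal.ofReal_le_ofReal
        (UniformLGC.Kexp_le_Kexp hCd (by linarith) (by positivity)))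
    · exact (hmN N).trans (ENNReal.ofReal_le_ofReal
        (UniformLGC.Kexp_le_Kexp hCm (by linarith) (by positivity)))
    · have h := heN N
      simp only [Real.norm_eq_abs] at h
      exact h.trans (ENNReal.ofReal_le_ofReal
        (UniformLGC.Kexp_le_Kexp hCe (by linarith) (by positivity)))
  refine ⟨Cd + Cm + Ce, hC3, fun N => ?_⟩
  simpa only [hQ] using hfinal N

end Summit.AtomisticToContinuum.HydrodynamicLimit.Theorems
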